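import Summits.QuantumFields.YangMills.Theorems.UnitScaleTiltHalvingP1FlatCoreTopSizesGamma
import Summits.QuantumFields.YangMills.Theorems.UnitScaleTiltHalvingP1FlatCoreTopSizesChart
import Summits.QuantumFields.YangMills.Theorems.UnitScaleTiltHalvingP1FlatCoreWindowSizesOfSideTouches
import HarnessLib

/-!
# Line H (`BirthV10.stub_halvingStep`, stmt-QuantumFields-19200) — ROAD γ (LEAD-H WORD 21 (γ-1)), T2γ∕T3γ:
# ★★★ THE LEVEL-CUBE SIZES (hX1)∕(hX2) AND THE [R-h] WIRING `hX_of_topRows_γ` ON THE γ IN-EDGE (box law «box ⊂ Ω_{j−1}», [3]-windows one level lower)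

Cell `ym3-torus` (HUMAN RULING D-0037: YM₃ on T³ is ladder rung R3 — NOT d = 4, NOT a mass gap, NOT the Clay problem).  Twins of ✓`HalvingP1FlatCoreTopSizes.levelCubeSizes_of_prop3_top`
(★w6-19200 g2) and ✓p647823 `hX_of_topRows` — PURE RELAYS: the five [3]-window rows and the box law `hbox` re-lettered to ✓`prop3_sizes_top_γ`'s (T1γ), the in-edge
`H59 ↦ H59γ` with lit's exterior-data rows `{Bbd a} hBbd ha0 ha hbdry haα h66 hlay` and the support clause threaded (`hu₁S : u₁ = 1` off `Ω₀`, `hsupp : λ = 0` off `Ω₀` ⇒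
the composite gauge `u₁·e^{iλ} = 1` off `Ω₀`); class `Λb` PARAMETRIC; proofs verbatim.  Bytes: ★ym-ust-20520-w3 g8's banked β draft `…TopSizesOfTopRowsBdryBeta`, γ re-lettering
ym-ust-19936-w2 g9.  `--supports stmt-QuantumFields-19200 --as helper`; THEOREMS ONLY (0 `def`, 0 `sorry`); count-neutral; nothing of Prop. 3, [4] Thm 3.3, the stub, the crux or
the gap is claimed (A6 note of `…TopSizesGamma` applies verbatim: `H59γ` is a displayed hypothesis, satisfiable at the member's class `cubeLamBP'`, vacuous over a «box ⊂ Ω_j» class).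

References: T. Bałaban, CMP **99** (1985) 75–102 [Balaban1985RegularSpaces] (Prop. 3 (1.62) p.87, (1.59) p.86, Thm 4 p.88, (1.108) p.94, (1.110)–(1.111) p.95, (1.36) p.82,
(1.31) p.82, (1.131) p.99); CMP **99** (1985) 389–434 [Balaban1985BackgroundPropagators] (Thm 3.3 p.399); CMP **96** (1984) 223–250 [Balaban1984PropagatorsII] ((2.3) p.224).
-/

set_option autoImplicit false

noncomputable section

open scoped BigOperators
open NormedSpace

namespace Summit.QuantumFields.YangMills.Theorems.HalvingP1FlatCoreTopSizesGamma

open Literature.MathematicalPhysics.QuantumFieldTheory.Balaban1983to89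
open Complex (I)
open MatrixLog B7Prop1Explicit B7Prop2Explicit B7Prop1Local B7Eq92Concrete
open B7Prop1Explicit renaming Site → LSite
open B8Lemma1NonAbelian (mulCfg)
open B8Ineq132 (covDerivFwd InAk BondTouches)
open B8Eq140Level (SideTouches)
open B8Eq119TwistedAxial (Restr129)
open B8Eq184Proof (gaugeExp cfgExp)
open B8Eq146AExpansion (iEta)
open B8Eq138LandauZd (logCfg)
open B7Prop4GeneralLevels (logCovIter linCovIter)
open B8Eq155JBound (Jcur wsup)
open B8ScaledSupNorm (bondNorm msup)
open B7Prop3Flat (c3)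
open B8Eq131Cubes (cube)
open B9SupplySockB9P3ZdBeta (CrossB)
open HalvingP1FlatCoreWindowSizesOfSideTouches (sideTouches_of_mem levelCubeSup_of_sideTouches levelCubeGrad_of_sideTouches)
open HalvingP1FlatCoreTopSizes (datumGuards_gaugeFixed inputRow_levelShift hWA_gaugeFixed_of_sizes)

variable {d : ℕ} {𝔸 : Type*} [CStarAlgebra 𝔸] [Nontrivial 𝔸]

/-! ## §1 The level-cube reading at the flat background -/

/-- ★★ **THE LEVEL-CUBE SIZES (hX1)∕(hX2) FROM PROPOSITION 3 AT THE TOP, THE (1.59) IN-EDGE IN EDITION γ, FLAT BACKGROUND `U₀ = 1`** (twin of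
✓`HalvingP1FlatCoreTopSizes.levelCubeSizes_of_prop3_top`, `H59 ↦ H59γ` + lit's γ binders + the support clause): under §1's displayed inputs at `U₀ := 1` and
`□_j := cube L a M′ ρ′ k j ⊆ Ω j` (`j ≤ k`): `(Lʲη)·‖A z ν‖ ≤ c⋆` on `□_j`, and `(Lʲη)²·η⁻¹·‖A (z + e_{ν′}) ν − A z ν‖ ≤ c⋆` for `z ∈ □_j` with `z + e_{ν′} ∈ □_0` — EXACTLY the
(hX1)∕(hX2) letters of ✓`HalvingP1FlatCoreWindowSizes.hsize_of_windowSizes`. [cite: Balaban1985RegularSpaces, Prop. 3 (1.62) p.87, (1.36) p.82, (1.131) p.99, (1.31) p.82; Balaban1985BackgroundPropagators, Thm 3.3 p.399] -/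
theorem levelCubeSizes_of_prop3_top_γ (hd2 : 2 ≤ d) {η : ℝ} (hη : 0 < η) {L : ℕ} (hL : 2 ≤ L) (k : ℕ)
    {U' : LSite d → Fin d → 𝔸ˣ} (hU' : ∀ x κ, U' x κ ∈ unitaryUnits 𝔸)
    {α₀ α₁ α₄ B₀ cstar : ℝ} (hα₀ : 0 < α₀) (hα₁ : 0 ≤ α₁) (hα₄ : 0 ≤ α₄) (hB₀ : 0 ≤ B₀)
    (hc : cstar = 5 * d * L * B₀ * (α₀ + α₁))
    (hα3 : C0 d * ((L : ℝ) ^ 2 * α₀) ≤ 1 / 3) (hα4 : 4 * ((L : ℝ) ^ 2 * α₀) ≤ c2' d L)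
    (h16 : 16 * (2 * (L * cstar) + 8 * α₄) ≤ 1) (hd5 : 5 * (2 * (L * cstar) + 8 * α₄) * ((d : ℝ) - 1) ≤ 4)
    (hsmall : Real.exp (4 * (800 * ((d : ℝ) + 1) ^ 2 * ((d : ℝ) + 4)) * ((L : ℝ) ^ 2 * α₀))
      * (1 + 8 * (131072 * ((d : ℝ) + 1) ^ 2) * ((L : ℝ) * (2 * (L * cstar) + 8 * α₄))) ≤ 2)
    (hc₃ : 2 * ((L : ℝ) * (2 * (L * cstar) + 8 * α₄)) ≤ c3 d L) (hside : 36 * d * B₀ * (2 * (L * cstar) + 8 * α₄) ≤ 1 / 2)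
    (h50 : 50 * d * (2 * (L * cstar) + 8 * α₄) ≤ 1)
    {C₂ : ℝ} (hC₂ : 8 * (131072 * ((d : ℝ) + 1) ^ 2) * Real.exp (4 * (800 * ((d : ℝ) + 1) ^ 2 * ((d : ℝ) + 4)) * ((L : ℝ) ^ 2 * α₀))
      * (L : ℝ) ^ 2 ≤ C₂)
    (h61 : 2 * (2 * (L * cstar) + 8 * α₄) ^ 2 + 20 * d * α₀ * (2 * (L * cstar) + 8 * α₄)
      + 2 * C₂ * (2 * (L * cstar) + 8 * α₄) ^ 2 ≤ α₀ + α₁)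
    {Bbd a : ℝ} (hBbd : 0 ≤ Bbd) (ha0 : 0 ≤ a) (ha : a ≤ 1 / 4) (hbdry : 4 * Bbd * a ≤ ((d : ℝ) * L - 1) * B₀ * (α₀ + α₁))
    (haα : a ≤ (d : ℝ) * L * α₁)
    (Ω : ℕ → Set (LSite d)) (Λs : ℕ → ℕ → Set (LSite d)) (Λb : ℕ → ℕ → Set (LSite d × Fin d))
    (hbox : ∀ j, j ≤ k → ∀ c ∈ Λb k j, ∀ x, InBox (loK L j c.1) (bondHiK L j c.1 c.2) x → x ∈ Ω (j - 1))
    (h33 : InAk L k η α₀ Ω (1 : LSite d → Fin d → 𝔸ˣ)) (h34 : InAk L k η α₀ Ω (mulCfg U' (1 : LSite d → Fin d → 𝔸ˣ)))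
    (h66 : ∀ b ∈ {b : LSite d × Fin d | SideTouches (Ω 0) b.1 b.2}, ‖((U' b.1 b.2 : 𝔸ˣ) : 𝔸) - 1‖ ≤ a)
    (hlay : ∀ y z : LSite d, y ∈ Ω 0 → z ∉ Ω 0 → (∀ i, y i - 1 ≤ z i ∧ z i ≤ y i + 1) → y ∈ Λs k 0)
    (Lan : ℕ → (LSite d → Fin d → 𝔸ˣ) → Prop)
    (H42 : ∀ (u : LSite d → 𝔸ˣ) (W : LSite d → Fin d → 𝔸ˣ) (A' : LSite d → Fin d → 𝔸),
      (∀ x, u x ∈ unitaryUnits 𝔸) → mgauge (1 : LSite d → Fin d → 𝔸ˣ) u W = U' → Restr129 L k (Λs k) (1 : LSite d → Fin d → 𝔸ˣ) u → Lan k W →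
      (∀ y τ, IsSelfAdjoint (A' y τ)) →
      (∀ j, j ≤ k → ∀ y τ, SideTouches (Ω j) y τ →
        W y τ = cfgExp η A' y τ ∧ ‖A' y τ‖ ≤ (2 * (L * cstar) + 8 * α₄) * ((L : ℝ) ^ j * η)⁻¹) →
      (∀ y τ, (∀ j, j ≤ k → ¬ SideTouches (Ω j) y τ) → A' y τ = 0) →
      ∀ j, j ≤ k → ∀ c ∈ Λb k j, ‖logCovIter L (1 : LSite d → Fin d → 𝔸ˣ) (iEta η A') j c.1 c.2‖ < 2 * d * L * α₁)
    (H59γ : ∀ (u : LSite d → 𝔸ˣ) (W : LSite d → Fin d → 𝔸ˣ) (A' : LSite d → Fin d → 𝔸),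
      (∀ x, u x ∈ unitaryUnits 𝔸) → (∀ x, x ∉ Ω 0 → u x = 1) → mgauge (1 : LSite d → Fin d → 𝔸ˣ) u W = U' →
      Restr129 L k (Λs k) (1 : LSite d → Fin d → 𝔸ˣ) u → Lan k W →
      (∀ y τ, IsSelfAdjoint (A' y τ)) →
      (∀ j, j ≤ k → ∀ y τ, SideTouches (Ω j) y τ →
        W y τ = cfgExp η A' y τ ∧ ‖A' y τ‖ ≤ (2 * (L * cstar) + 8 * α₄) * ((L : ℝ) ^ j * η)⁻¹) →
      (∀ y τ, (∀ j, j ≤ k → ¬ SideTouches (Ω j) y τ) → A' y τ = 0) →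
      msup L k η (-(1 : ℝ)) (fun j (b : LSite d × Fin d) => SideTouches (Ω j) b.1 b.2) (fun b => A' b.1 b.2)
          ≤ B₀ * (bondNorm L k η (-(3 : ℝ)) Ω (fun x μ => Jcur η (1 : LSite d → Fin d → 𝔸ˣ) A' μ x)
            + wsup 1 (fun p : {p : ℕ × (LSite d × Fin d) // p.1 ≤ k ∧ (p.2 ∈ Λb k p.1 ∨ (p.1 = 0 ∧ CrossB (Ω 0) p.2))} =>
                linCovIter L (1 : LSite d → Fin d → 𝔸ˣ) (iEta η A') p.1.1 p.1.2.1 p.1.2.2))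
            + Bbd * msup L k η (-(1 : ℝ)) (fun j (b : LSite d × Fin d) => j = 0 ∧ SideTouches (Ω 0) b.1 b.2 ∧ ¬ BondTouches (Ω 0) b.1 b.2)
                (fun b => A' b.1 b.2) ∧
        msup L k η (-(2 : ℝ)) (fun j (t : Fin d × Fin d × LSite d) => SideTouches (Ω j) t.2.2 t.2.1)
            (fun t => covDerivFwd η (1 : LSite d → Fin d → 𝔸ˣ) t.1 (fun z => A' z t.2.1) t.2.2)
          ≤ B₀ * (bondNorm L k η (-(3 : ℝ)) Ω (fun x μ => Jcur η (1 : LSite d → Fin d → 𝔸ˣ) A' μ x)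
            + wsup 1 (fun p : {p : ℕ × (LSite d × Fin d) // p.1 ≤ k ∧ (p.2 ∈ Λb k p.1 ∨ (p.1 = 0 ∧ CrossB (Ω 0) p.2))} =>
                linCovIter L (1 : LSite d → Fin d → 𝔸ˣ) (iEta η A') p.1.1 p.1.2.1 p.1.2.2))
            + Bbd * msup L k η (-(1 : ℝ)) (fun j (b : LSite d × Fin d) => j = 0 ∧ SideTouches (Ω 0) b.1 b.2 ∧ ¬ BondTouches (Ω 0) b.1 b.2)
                (fun b => A' b.1 b.2))
    (u : LSite d → 𝔸ˣ) (W : LSite d → Fin d → 𝔸ˣ) (A : LSite d → Fin d → 𝔸)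
    (hu : ∀ x, u x ∈ unitaryUnits 𝔸) (huS : ∀ x, x ∉ Ω 0 → u x = 1) (hW : mgauge (1 : LSite d → Fin d → 𝔸ˣ) u W = U')
    (h129 : Restr129 L k (Λs k) (1 : LSite d → Fin d → 𝔸ˣ) u) (hLan : Lan k W)
    (hWA : ∀ j, j ≤ k → ∀ y τ, SideTouches (Ω j) y τ →
      W y τ = cfgExp η A y τ ∧ ‖A y τ‖ ≤ (2 * (L * cstar) + 8 * α₄) * ((L : ℝ) ^ j * η)⁻¹)
    -- the level cubes inside the domains
    {a₀ : LSite d} {M' ρ' : ℕ} (hΩ : ∀ j, j ≤ k → cube L a₀ M' ρ' k j ⊆ Ω j) :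
    (∀ j, j ≤ k → ∀ z ∈ cube L a₀ M' ρ' k j, ∀ ν : Fin d, (L : ℝ) ^ j * η * ‖A z ν‖ ≤ cstar) ∧
    (∀ j, j ≤ k → ∀ z ∈ cube L a₀ M' ρ' k j, ∀ ν ν' : Fin d, z + e ν' ∈ cube L a₀ M' ρ' k 0 →
      ((L : ℝ) ^ j * η) ^ 2 * η⁻¹ * ‖A (z + e ν') ν - A z ν‖ ≤ cstar) := by
  have hL1 : 1 ≤ L := le_trans (by norm_num) hL
  have hU₀ : ∀ (x : LSite d) (κ : Fin d), (1 : LSite d → Fin d → 𝔸ˣ) x κ ∈ unitaryUnits 𝔸 := fun _ _ => (unitaryUnits 𝔸).one_mem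
  obtain ⟨A', -, hAA, hsup, hgrad⟩ := prop3_sizes_top_γ hd2 hη hL k hU₀ hU' hα₀ hα₁ hα₄ hB₀ hc hα3 hα4 h16 hd5 hsmall hc₃ hside h50 hC₂
    h61 hBbd ha0 ha hbdry haα Ω Λs Λb hbox h33 h34 h66 hlay Lan H42 H59γ u W A hu huS hW h129 hLan hWA
  refine ⟨levelCubeSup_of_sideTouches hd2 hL1 hη Ω hΩ A hsup, fun j hj z hz ν ν' hz' => ?_⟩
  -- the gradient row for the masked field on the cubes, then back to `A` at both bonds
  have h := levelCubeGrad_of_sideTouches hd2 hη Ω hΩ A' (c := cstar) (fun j hj z ν ν' hs => hgrad j hj z ν' ν hs) j hj z hz ν ν'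
  have h1 : A' z ν = A z ν := hAA j hj z ν (sideTouches_of_mem hd2 (hΩ j hj hz) ν)
  have h2 : A' (z + e ν') ν = A (z + e ν') ν := hAA 0 (Nat.zero_le k) (z + e ν') ν (sideTouches_of_mem hd2 (hΩ 0 (Nat.zero_le k) hz') ν)
  rwa [h1, h2] at h


/-! ## §2 The [R-h] wiring on the γ in-edge -/

/-- ★★★ **THE [R-h] WIRING ON THE γ IN-EDGE: THE DOOR's SIZE ROWS FOR `X₀ := logCfg η W^λ` FROM THEOREM 4's DATUM (WITH SUPPORT CLAUSE) AND THE TOP STEP's `λ`** (twin of ✓p647823 `hX_of_topRows`, `H59 ↦ H59γ` + lit's γ rows + `hu₁S`, `hsupp`).  Inputs: Proposition 3's standing rows at the flat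
background (✓`levelCubeSizes_of_prop3_top_γ`'s, passed through verbatim: `U′` unitary, windows at `α₂ = 2(L·c⋆) + 8α₄`, `Ω Λs Λb hbox`, (1.33) `h33`, (1.34) `h34`, `Lan`, the level-`k`
sockets `H42`∕`H59γ`, (1.66)₀ `h66`, `hlay`, the exterior-data scalars), `Ω` antitone, `□_j := cube L a M′ ρ′ k j ⊆ Ω_j`; Theorem 4's datum at level `k − 1` (`u₁` unitary-valued, `W^{u₁} = U′`, and on the sides touching `Ω_j`, `j ≤ k−1`:
`W = e^{iηA}`, `A` self-adjoint, `‖A‖ ≤ c⋆(Lʲη)⁻¹`); the top step's `λ` (self-adjoint; (1.108) on the sides touching `Ω_j`, `j ≤ k`); and the two guards of the composite gauge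
`u₁e^{iλ}` — (1.29) `Restr129 L k (Λs k) 1 (u₁·gaugeExp λ)` and `Lan k W′`, `W′ := mgauge 1 (gaugeExp λ)⁻¹ W`.  Output: the (hX1)∕(hX2) pair for `X₀ := logCfg η (mgauge 1 (gaugeExp λ)⁻¹ (cfgExp η A))`
with `c := c⋆`.  Proof: ✓`datumGuards_gaugeFixed` (`hu`, `hW`), ✓`inputRow_levelShift` + ✓`hWA_gaugeFixed_of_sizes` (the a priori chart row, transported from `W^λ` to `W′` bond-wise on
the sides), ✓`levelCubeSizes_of_prop3_top_γ`, and the bond-wise transport `logCfg η W′ = X₀` back on the cube bonds.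
[cite: Balaban1985RegularSpaces, Prop. 3 (1.62) p.87, (1.59) p.86, Thm 4 p.88, (1.108) p.94, (1.110)-(1.111) p.95, (1.36) p.82, (1.31) p.82; Balaban1985BackgroundPropagators, Thm 3.3 p.399] -/
theorem hX_of_topRows_γ (hd2 : 2 ≤ d) {η : ℝ} (hη : 0 < η) {L : ℕ} (hL : 2 ≤ L) {k : ℕ} (hk1 : 1 ≤ k)
    {U' : LSite d → Fin d → 𝔸ˣ} (hU' : ∀ x κ, U' x κ ∈ unitaryUnits 𝔸)
    {α₀ α₁ α₄ B₀ cstar : ℝ} (hα₀ : 0 < α₀) (hα₁ : 0 ≤ α₁) (hα₄ : 0 ≤ α₄) (hB₀ : 0 ≤ B₀)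
    (hc : cstar = 5 * d * L * B₀ * (α₀ + α₁))
    (hα3 : C0 d * ((L : ℝ) ^ 2 * α₀) ≤ 1 / 3) (hα4 : 4 * ((L : ℝ) ^ 2 * α₀) ≤ c2' d L)
    (h16 : 16 * (2 * (L * cstar) + 8 * α₄) ≤ 1) (hd5 : 5 * (2 * (L * cstar) + 8 * α₄) * ((d : ℝ) - 1) ≤ 4)
    (hsmall : Real.exp (4 * (800 * ((d : ℝ) + 1) ^ 2 * ((d : ℝ) + 4)) * ((L : ℝ) ^ 2 * α₀))
      * (1 + 8 * (131072 * ((d : ℝ) + 1) ^ 2) * ((L : ℝ) * (2 * (L * cstar) + 8 * α₄))) ≤ 2)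
    (hc₃ : 2 * ((L : ℝ) * (2 * (L * cstar) + 8 * α₄)) ≤ c3 d L) (hside : 36 * d * B₀ * (2 * (L * cstar) + 8 * α₄) ≤ 1 / 2)
    (h50 : 50 * d * (2 * (L * cstar) + 8 * α₄) ≤ 1)
    {C₂ : ℝ} (hC₂ : 8 * (131072 * ((d : ℝ) + 1) ^ 2) * Real.exp (4 * (800 * ((d : ℝ) + 1) ^ 2 * ((d : ℝ) + 4)) * ((L : ℝ) ^ 2 * α₀))
      * (L : ℝ) ^ 2 ≤ C₂)
    (h61 : 2 * (2 * (L * cstar) + 8 * α₄) ^ 2 + 20 * d * α₀ * (2 * (L * cstar) + 8 * α₄)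
      + 2 * C₂ * (2 * (L * cstar) + 8 * α₄) ^ 2 ≤ α₀ + α₁)
    -- edition β: lit's scalar binders
    {Bbd a : ℝ} (hBbd : 0 ≤ Bbd) (ha0 : 0 ≤ a) (ha : a ≤ 1 / 4) (hbdry : 4 * Bbd * a ≤ ((d : ℝ) * L - 1) * B₀ * (α₀ + α₁))
    (haα : a ≤ (d : ℝ) * L * α₁)
    (Ω : ℕ → Set (LSite d)) (hΩanti : ∀ j, Ω (j + 1) ⊆ Ω j) (Λs : ℕ → ℕ → Set (LSite d)) (Λb : ℕ → ℕ → Set (LSite d × Fin d))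
    (hbox : ∀ j, j ≤ k → ∀ c ∈ Λb k j, ∀ x, InBox (loK L j c.1) (bondHiK L j c.1 c.2) x → x ∈ Ω (j - 1))
    (h33 : InAk L k η α₀ Ω (1 : LSite d → Fin d → 𝔸ˣ)) (h34 : InAk L k η α₀ Ω (mulCfg U' (1 : LSite d → Fin d → 𝔸ˣ)))
    -- edition β: (1.66)₀ on the sides touching `Ω₀`, the boundary-layer law at level `k`
    (h66 : ∀ b ∈ {b : LSite d × Fin d | SideTouches (Ω 0) b.1 b.2}, ‖((U' b.1 b.2 : 𝔸ˣ) : 𝔸) - 1‖ ≤ a)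
    (hlay : ∀ y z : LSite d, y ∈ Ω 0 → z ∉ Ω 0 → (∀ i, y i - 1 ≤ z i ∧ z i ≤ y i + 1) → y ∈ Λs k 0)
    (Lan : ℕ → (LSite d → Fin d → 𝔸ˣ) → Prop)
    (H42 : ∀ (u : LSite d → 𝔸ˣ) (W : LSite d → Fin d → 𝔸ˣ) (A' : LSite d → Fin d → 𝔸),
      (∀ x, u x ∈ unitaryUnits 𝔸) → mgauge (1 : LSite d → Fin d → 𝔸ˣ) u W = U' → Restr129 L k (Λs k) (1 : LSite d → Fin d → 𝔸ˣ) u → Lan k W →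
      (∀ y τ, IsSelfAdjoint (A' y τ)) →
      (∀ j, j ≤ k → ∀ y τ, SideTouches (Ω j) y τ →
        W y τ = cfgExp η A' y τ ∧ ‖A' y τ‖ ≤ (2 * (L * cstar) + 8 * α₄) * ((L : ℝ) ^ j * η)⁻¹) →
      (∀ y τ, (∀ j, j ≤ k → ¬ SideTouches (Ω j) y τ) → A' y τ = 0) →
      ∀ j, j ≤ k → ∀ c ∈ Λb k j, ‖logCovIter L (1 : LSite d → Fin d → 𝔸ˣ) (iEta η A') j c.1 c.2‖ < 2 * d * L * α₁)
    (H59γ : ∀ (u : LSite d → 𝔸ˣ) (W : LSite d → Fin d → 𝔸ˣ) (A' : LSite d → Fin d → 𝔸),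
      (∀ x, u x ∈ unitaryUnits 𝔸) → (∀ x, x ∉ Ω 0 → u x = 1) → mgauge (1 : LSite d → Fin d → 𝔸ˣ) u W = U' →
      Restr129 L k (Λs k) (1 : LSite d → Fin d → 𝔸ˣ) u → Lan k W →
      (∀ y τ, IsSelfAdjoint (A' y τ)) →
      (∀ j, j ≤ k → ∀ y τ, SideTouches (Ω j) y τ →
        W y τ = cfgExp η A' y τ ∧ ‖A' y τ‖ ≤ (2 * (L * cstar) + 8 * α₄) * ((L : ℝ) ^ j * η)⁻¹) →
      (∀ y τ, (∀ j, j ≤ k → ¬ SideTouches (Ω j) y τ) → A' y τ = 0) →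
      msup L k η (-(1 : ℝ)) (fun j (b : LSite d × Fin d) => SideTouches (Ω j) b.1 b.2) (fun b => A' b.1 b.2)
          ≤ B₀ * (bondNorm L k η (-(3 : ℝ)) Ω (fun x μ => Jcur η (1 : LSite d → Fin d → 𝔸ˣ) A' μ x)
            + wsup 1 (fun p : {p : ℕ × (LSite d × Fin d) // p.1 ≤ k ∧ (p.2 ∈ Λb k p.1 ∨ (p.1 = 0 ∧ CrossB (Ω 0) p.2))} =>
                linCovIter L (1 : LSite d → Fin d → 𝔸ˣ) (iEta η A') p.1.1 p.1.2.1 p.1.2.2))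
            + Bbd * msup L k η (-(1 : ℝ)) (fun j (b : LSite d × Fin d) => j = 0 ∧ SideTouches (Ω 0) b.1 b.2 ∧ ¬ BondTouches (Ω 0) b.1 b.2)
                (fun b => A' b.1 b.2) ∧
        msup L k η (-(2 : ℝ)) (fun j (t : Fin d × Fin d × LSite d) => SideTouches (Ω j) t.2.2 t.2.1)
            (fun t => covDerivFwd η (1 : LSite d → Fin d → 𝔸ˣ) t.1 (fun z => A' z t.2.1) t.2.2)
          ≤ B₀ * (bondNorm L k η (-(3 : ℝ)) Ω (fun x μ => Jcur η (1 : LSite d → Fin d → 𝔸ˣ) A' μ x)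
            + wsup 1 (fun p : {p : ℕ × (LSite d × Fin d) // p.1 ≤ k ∧ (p.2 ∈ Λb k p.1 ∨ (p.1 = 0 ∧ CrossB (Ω 0) p.2))} =>
                linCovIter L (1 : LSite d → Fin d → 𝔸ˣ) (iEta η A') p.1.1 p.1.2.1 p.1.2.2))
            + Bbd * msup L k η (-(1 : ℝ)) (fun j (b : LSite d × Fin d) => j = 0 ∧ SideTouches (Ω 0) b.1 b.2 ∧ ¬ BondTouches (Ω 0) b.1 b.2)
                (fun b => A' b.1 b.2))
    -- Theorem 4's datum at level `k − 1`
    (u₁ : LSite d → 𝔸ˣ) (W : LSite d → Fin d → 𝔸ˣ) (A : LSite d → Fin d → 𝔸)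
    (hu₁ : ∀ x, u₁ x ∈ unitaryUnits 𝔸) (hu₁S : ∀ x, x ∉ Ω 0 → u₁ x = 1) (hWd : mgauge (1 : LSite d → Fin d → 𝔸ˣ) u₁ W = U')
    (hdat : ∀ j, j ≤ k - 1 → ∀ (y : LSite d) (τ : Fin d), SideTouches (Ω j) y τ →
      W y τ = cfgExp η A y τ ∧ IsSelfAdjoint (A y τ) ∧ ‖A y τ‖ ≤ cstar * ((L : ℝ) ^ j * η)⁻¹)
    -- the top step's `λ`
    (lam : LSite d → 𝔸) (hsa : ∀ x, IsSelfAdjoint (lam x)) (hsupp : ∀ x, x ∉ Ω 0 → lam x = 0)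
    (h108 : ∀ j, j ≤ k → ∀ (y : LSite d) (τ : Fin d), SideTouches (Ω j) y τ →
      ‖lam y‖ ≤ α₄ ∧ ((L : ℝ) ^ j * η) * ‖covDerivFwd η (1 : LSite d → Fin d → 𝔸ˣ) τ lam y‖ ≤ α₄)
    -- the two guards of the composite gauge (displayed)
    (h129 : Restr129 L k (Λs k) (1 : LSite d → Fin d → 𝔸ˣ) (u₁ * gaugeExp lam))
    (hLan : Lan k (mgauge (1 : LSite d → Fin d → 𝔸ˣ) (gaugeExp lam)⁻¹ W))
    -- the level cubes inside the domains
    {a₀ : LSite d} {M' ρ' : ℕ} (hΩ : ∀ j, j ≤ k → cube L a₀ M' ρ' k j ⊆ Ω j) :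
    (∀ j, j ≤ k → ∀ z ∈ cube L a₀ M' ρ' k j, ∀ ν : Fin d,
      (L : ℝ) ^ j * η * ‖logCfg η (mgauge (1 : LSite d → Fin d → 𝔸ˣ) (gaugeExp lam)⁻¹ (cfgExp η A)) z ν‖ ≤ cstar) ∧
    (∀ j, j ≤ k → ∀ z ∈ cube L a₀ M' ρ' k j, ∀ ν ν' : Fin d, z + e ν' ∈ cube L a₀ M' ρ' k 0 →
      ((L : ℝ) ^ j * η) ^ 2 * η⁻¹ *
        ‖logCfg η (mgauge (1 : LSite d → Fin d → 𝔸ˣ) (gaugeExp lam)⁻¹ (cfgExp η A)) (z + e ν') ν -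
          logCfg η (mgauge (1 : LSite d → Fin d → 𝔸ˣ) (gaugeExp lam)⁻¹ (cfgExp η A)) z ν‖ ≤ cstar) := by
  have hL1 : 1 ≤ L := le_trans (by norm_num) hL
  have hLr : (1 : ℝ) ≤ L := by exact_mod_cast hL1
  have hcstar : 0 ≤ cstar := by rw [hc]; positivity
  -- the two windows of (1.110) follow from Proposition 3's `16·α₂ ≤ 1`
  have hs₁ : α₄ ≤ 1 / 84 := by nlinarith [mul_nonneg (show (0:ℝ) ≤ L by positivity) hcstar]
  have hs₂ : (L : ℝ) * cstar ≤ 1 / 12 := by nlinarith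
  -- letters: the gauge-fixed DATUM field `W′` and the door's `W^λ`
  set W' : LSite d → Fin d → 𝔸ˣ := mgauge (1 : LSite d → Fin d → 𝔸ˣ) (gaugeExp lam)⁻¹ W with hW'def
  set Wl : LSite d → Fin d → 𝔸ˣ := mgauge (1 : LSite d → Fin d → 𝔸ˣ) (gaugeExp lam)⁻¹ (cfgExp η A) with hWldef
  -- the datum's chart clause on every side touching some `Ω_j`, `j ≤ k` (antitone `Ω`, datum at `k − 1`)
  have hchart : ∀ j, j ≤ k → ∀ (y : LSite d) (τ : Fin d), SideTouches (Ω j) y τ → W y τ = cfgExp η A y τ := by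
    intro j hj y τ hs
    rcases Nat.lt_or_ge j k with hjk | hjk
    · exact (hdat j (by omega) y τ hs).1
    · have hjk' : j = k := le_antisymm hj hjk
      have hsub : Ω j ⊆ Ω (k - 1) := by
        have h := hΩanti (k - 1)
        rw [Nat.sub_add_cancel hk1] at h
        rw [hjk']; exact h
      exact (hdat (k - 1) le_rfl y τ (B8Eq140Level.sideTouches_mono hsub hs)).1
  -- bond-wise agreement `W′ = W^λ` on those sides
  have hWW : ∀ j, j ≤ k → ∀ (y : LSite d) (τ : Fin d), SideTouches (Ω j) y τ → W' y τ = Wl y τ := by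
    intro j hj y τ hs
    rw [hW'def, hWldef, mgauge_apply, mgauge_apply, hchart j hj y τ hs]
  -- the guards `hu`, `hW` of the composite gauge (global)
  obtain ⟨hu, hW⟩ := datumGuards_gaugeFixed (1 : LSite d → Fin d → 𝔸ˣ) U' W u₁ lam hu₁ hsa hWd
  -- the support clause of the composite gauge `u₁·e^{iλ}` (`u₁ = 1` and `λ = 0` off `Ω₀`)
  have huS : ∀ x, x ∉ Ω 0 → (u₁ * gaugeExp lam) x = 1 := by
    intro x hx
    have hg : gaugeExp lam x = 1 := by
      ext
      simp [gaugeExp, hsupp x hx]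
    rw [Pi.mul_apply, hu₁S x hx, hg, one_mul]
  -- the a priori chart row of `W^λ`, transported to `W′`
  have h69 : ∀ j, j ≤ k → ∀ (y : LSite d) (τ : Fin d), SideTouches (Ω j) y τ → ‖A y τ‖ ≤ L * cstar * ((L : ℝ) ^ j * η)⁻¹ := by
    have h := inputRow_levelShift hη hL1 (k - 1) Ω hΩanti A hcstar fun j hj y τ hs => (hdat j hj y τ hs).2.2
    rwa [Nat.sub_add_cancel hk1] at h
  have hWA : ∀ j, j ≤ k → ∀ (y : LSite d) (τ : Fin d), SideTouches (Ω j) y τ →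
      W' y τ = cfgExp η (logCfg η W') y τ ∧ ‖logCfg η W' y τ‖ ≤ (2 * (L * cstar) + 8 * α₄) * ((L : ℝ) ^ j * η)⁻¹ := by
    intro j hj y τ hs
    obtain ⟨hexp, hbd⟩ := hWA_gaugeFixed_of_sizes hη hL1 k (1 : LSite d → Fin d → 𝔸ˣ) Ω A lam hcstar hα₄ hs₁ hs₂ h69 h108 j hj y τ hs
    have hlog : logCfg η W' y τ = logCfg η Wl y τ := by
      simp only [logCfg, hWW j hj y τ hs]
    refine ⟨?_, by rw [hlog]; exact hbd⟩
    rw [hWW j hj y τ hs, B8Prop3GaugeFixedKLevel.cfgExp_congr_at η hlog]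
    exact hexp
  -- PROPOSITION 3 at the top for the datum `(u₁e^{iλ}, W′, logCfg η W′)`
  obtain ⟨hX1, hX2⟩ := levelCubeSizes_of_prop3_top_γ hd2 hη hL k hU' hα₀ hα₁ hα₄ hB₀ hc hα3 hα4 h16 hd5 hsmall hc₃ hside h50 hC₂ h61
    hBbd ha0 ha hbdry haα Ω Λs Λb hbox h33 h34 h66 hlay Lan H42 H59γ (u₁ * gaugeExp lam) W' (logCfg η W') hu huS hW h129 hLan hWA hΩ
  -- back to `X₀ = logCfg η W^λ` on the cube bonds
  have hX : ∀ j, j ≤ k → ∀ z ∈ cube L a₀ M' ρ' k j, ∀ ν : Fin d, logCfg η W' z ν = logCfg η Wl z ν := fun j hj z hz ν => by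
    simp only [logCfg, hWW j hj z ν (sideTouches_of_mem hd2 (hΩ j hj hz) ν)]
  refine ⟨fun j hj z hz ν => ?_, fun j hj z hz ν ν' hz' => ?_⟩
  · rw [← hX j hj z hz ν]; exact hX1 j hj z hz ν
  · rw [← hX j hj z hz ν, ← hX 0 (Nat.zero_le k) (z + e ν') hz' ν]; exact hX2 j hj z hz ν ν' hz'

end Summit.QuantumFields.YangMills.Theorems.HalvingP1FlatCoreTopSizesGamma

end
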